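import Literature.Topology.FourManifolds.TautFoliationsConeSquare
import HarnessLib

/-!
# Contour lines of the cone of a square with a roof apex

Topic: the singular foliation induced on a square `Q = closedBall c ℓ` of the plane (max norm)
by the cone interpolation of `TautFoliationsConeSquare.lean` when the **apex height `m` is a
roof**: `ψ q < m` for every boundary point `q`, where `ψ` is the boundary height (in the
construction of the `C⁰` general position, the height in the flow box of the square of the
tame skeleton map; choosing all apexes above the boundary maxima is admissible since the
skeleton lies in the open sub-box of radius `ρ / 2`). The height of the cone is then
`coneHt x = (1 - radial x) m + radial x · ψ (proj x)`, i.e. `m - r (m - ψ q)` along the ray to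
`q`: **strictly decreasing along every ray**. Consequences (all elementary, fully proved):

* `ConeSquare.coneHt`, `ConeSquare.levelPt q h = c + ((m - h) / (m - ψ q)) • (q - c)`
  (**definitions**);
* `coneHt_levelPt` / `eq_levelPt_of_coneHt_eq`: **the level set of height `h < m` in the
  punctured square is the graph `q ↦ levelPt q h` over the boundary arc `{q | ψ q ≤ h}`**, a
  closed contour around the centre when `h` exceeds `max ψ`, chords touching the boundary
  exactly where `ψ q = h` otherwise;
* `levelPt_mem_closedBall_iff`: `levelPt q h` lies in the square iff `ψ q ≤ h`;
* the **cone coordinates `x ↦ (proj x, coneHt x)` identify the punctured square with the region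
  `{(q, h) | q ∈ ∂Q, ψ q ≤ h < m}` over the boundary**, the induced foliation becoming the
  horizontal one `h = const` (`proj_levelPt`, `coneHt_levelPt`, `eq_levelPt_of_coneHt_eq`,
  `continuousOn_levelPt`): the centre is a *centre* singularity and there is no other
  singularity inside the square.

All statements are [folklore] (elementary real analysis; the use is Camacho–Lins Neto Ch. VI
§3–§4: the induced foliation of a disc in general position).
-/

open Set Filter Metric Topology

namespace Literature.Topology.FourManifolds

namespace ConeSquare

variable {c : ℝ × ℝ} {ℓ m : ℝ} {ψ : ℝ × ℝ → ℝ} {x q : ℝ × ℝ} {h t : ℝ}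

/-- **The height of the cone** with apex height `m` over the boundary heights `ψ`:
`(1 - radial x) m + radial x · ψ (proj x)`. [folklore] -/
noncomputable def coneHt (c : ℝ × ℝ) (ℓ m : ℝ) (ψ : ℝ × ℝ → ℝ) (x : ℝ × ℝ) : ℝ :=
  (1 - radial c ℓ x) * m + radial c ℓ x * ψ (proj c ℓ x)

/-- Unfolding lemma for `coneHt`. [folklore] -/
theorem coneHt_apply (c : ℝ × ℝ) (ℓ m : ℝ) (ψ : ℝ × ℝ → ℝ) (x : ℝ × ℝ) :
    coneHt c ℓ m ψ x = (1 - radial c ℓ x) * m + radial c ℓ x * ψ (proj c ℓ x) := rfl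

/-- `coneHt` is the height of the cone in box coordinates. [folklore] -/
theorem coneHt_eq_snd_cone {W : Type*} [NormedAddCommGroup W] [NormedSpace ℝ W] (c : ℝ × ℝ) (ℓ : ℝ)
    (w₀ : W × ℝ) (φ : ℝ × ℝ → W × ℝ) (x : ℝ × ℝ) :
    coneHt c ℓ w₀.2 (fun y ↦ (φ y).2) x = (cone c ℓ w₀ φ x).2 := by
  rw [coneHt_apply, snd_cone]

/-- The height at the centre is the apex height. [folklore] -/
@[simp] theorem coneHt_center (c : ℝ × ℝ) (ℓ m : ℝ) (ψ : ℝ × ℝ → ℝ) : coneHt c ℓ m ψ c = m := by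
  simp [coneHt_apply]

/-- **The height along a ray**: `m - t (m - ψ q)`. [folklore] -/
theorem coneHt_ray (hℓ : 0 < ℓ) (hq : q ∈ sphere c ℓ) (ht : 0 ≤ t) :
    coneHt c ℓ m ψ (c + t • (q - c)) = m - t * (m - ψ q) := by
  rcases ht.eq_or_lt with rfl | ht'
  · simp
  · rw [coneHt_apply, radial_ray hℓ hq ht, proj_ray hℓ hq ht']
    ring

/-- On the boundary the height is the boundary height. [folklore] -/
theorem coneHt_of_mem_sphere (hℓ : 0 < ℓ) (hx : x ∈ sphere c ℓ) : coneHt c ℓ m ψ x = ψ x := by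
  rw [coneHt_apply, radial_of_mem_sphere hℓ hx, proj_of_mem_sphere hℓ hx]
  ring

/-- The height in terms of the cone coordinates: `m - radial x · (m - ψ (proj x))`. [folklore] -/
theorem coneHt_eq (x : ℝ × ℝ) : coneHt c ℓ m ψ x = m - radial c ℓ x * (m - ψ (proj c ℓ x)) := by
  rw [coneHt_apply]; ring

/-- **The height is strictly decreasing along every ray** (roof apex). [folklore] -/
theorem strictAntiOn_coneHt_ray (hℓ : 0 < ℓ) (hq : q ∈ sphere c ℓ) (hm : ψ q < m) :
    StrictAntiOn (fun t : ℝ ↦ coneHt c ℓ m ψ (c + t • (q - c))) (Ici 0) := by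
  intro s hs t ht hst
  simp only
  rw [coneHt_ray hℓ hq hs, coneHt_ray hℓ hq ht]
  nlinarith

/-- **Below the apex**: in the square, off the centre, the height is `< m`. [folklore] -/
theorem coneHt_lt_apex (hℓ : 0 < ℓ) (hm : ∀ q ∈ sphere c ℓ, ψ q < m) (hxc : x ≠ c) : coneHt c ℓ m ψ x < m := by
  rw [coneHt_eq]
  have hr : 0 < radial c ℓ x := div_pos (dist_pos.2 hxc) hℓ
  have hψ := hm _ (proj_mem_sphere hℓ x)
  nlinarith

/-- **Above the boundary**: in the square the height is `≥ ψ (proj x)`. [folklore] -/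
theorem le_coneHt (hℓ : 0 < ℓ) (hm : ∀ q ∈ sphere c ℓ, ψ q < m) (hx : x ∈ closedBall c ℓ) :
    ψ (proj c ℓ x) ≤ coneHt c ℓ m ψ x := by
  rw [coneHt_eq]
  have hr := radial_mem_Icc hℓ hx
  have hψ := hm _ (proj_mem_sphere hℓ x)
  nlinarith [hr.1, hr.2]

/-! ## The level sets -/

/-- **The point of the level `h` on the ray to `q`**: radial parameter `(m - h) / (m - ψ q)`.
[folklore] -/
noncomputable def levelPt (c : ℝ × ℝ) (m : ℝ) (ψ : ℝ × ℝ → ℝ) (q : ℝ × ℝ) (h : ℝ) : ℝ × ℝ :=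
  c + ((m - h) / (m - ψ q)) • (q - c)

/-- The radial parameter of `levelPt` is nonnegative when `h ≤ m`. [folklore] -/
theorem levelParam_nonneg (hm : ψ q < m) (hh : h ≤ m) : 0 ≤ (m - h) / (m - ψ q) :=
  div_nonneg (by linarith) (by linarith)

/-- **`levelPt` has height `h`.** [folklore] -/
theorem coneHt_levelPt (hℓ : 0 < ℓ) (hq : q ∈ sphere c ℓ) (hm : ψ q < m) (hh : h ≤ m) :
    coneHt c ℓ m ψ (levelPt c m ψ q h) = h := by
  rw [levelPt, coneHt_ray hℓ hq (levelParam_nonneg hm hh), div_mul_cancel₀ _ (by linarith : m - ψ q ≠ 0)]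
  ring

/-- The radial coordinate of `levelPt`. [folklore] -/
theorem radial_levelPt (hℓ : 0 < ℓ) (hq : q ∈ sphere c ℓ) (hm : ψ q < m) (hh : h ≤ m) :
    radial c ℓ (levelPt c m ψ q h) = (m - h) / (m - ψ q) := by
  rw [levelPt, radial_ray hℓ hq (levelParam_nonneg hm hh)]

/-- The projection of `levelPt` (below the apex). [folklore] -/
theorem proj_levelPt (hℓ : 0 < ℓ) (hq : q ∈ sphere c ℓ) (hm : ψ q < m) (hh : h < m) :
    proj c ℓ (levelPt c m ψ q h) = q := by
  rw [levelPt, proj_ray hℓ hq (div_pos (by linarith) (by linarith))]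

/-- **`levelPt` lies in the square iff `ψ q ≤ h`.** [folklore] -/
theorem levelPt_mem_closedBall_iff (hℓ : 0 < ℓ) (hq : q ∈ sphere c ℓ) (hm : ψ q < m) (hh : h ≤ m) :
    levelPt c m ψ q h ∈ closedBall c ℓ ↔ ψ q ≤ h := by
  rw [mem_closedBall, dist_eq_mul_radial hℓ, radial_levelPt hℓ hq hm hh, mul_le_iff_le_one_right hℓ,
    div_le_one (by linarith)]
  constructor <;> intro h' <;> linarith

/-- `levelPt` lies strictly inside the square iff `ψ q < h`. [folklore] -/
theorem levelPt_mem_ball_iff (hℓ : 0 < ℓ) (hq : q ∈ sphere c ℓ) (hm : ψ q < m) (hh : h ≤ m) :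
    levelPt c m ψ q h ∈ ball c ℓ ↔ ψ q < h := by
  rw [mem_ball, dist_eq_mul_radial hℓ, radial_levelPt hℓ hq hm hh, mul_lt_iff_lt_one_right hℓ,
    div_lt_one (by linarith)]
  constructor <;> intro h' <;> linarith

/-- `levelPt` is on the boundary iff `ψ q = h`. [folklore] -/
theorem levelPt_mem_sphere_iff (hℓ : 0 < ℓ) (hq : q ∈ sphere c ℓ) (hm : ψ q < m) (hh : h ≤ m) :
    levelPt c m ψ q h ∈ sphere c ℓ ↔ ψ q = h := by
  rw [mem_sphere, dist_eq_mul_radial hℓ, radial_levelPt hℓ hq hm hh]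
  constructor
  · intro h'
    have : (m - h) / (m - ψ q) = 1 := by
      have h1 : ℓ * ((m - h) / (m - ψ q)) = ℓ * 1 := h'.trans (mul_one ℓ).symm
      exact mul_left_cancel₀ hℓ.ne' h1
    rw [div_eq_one_iff_eq (by linarith)] at this
    linarith
  · intro h'
    rw [h', div_self (by linarith), mul_one]

/-- `levelPt` is the centre iff `h = m`. [folklore] -/
theorem levelPt_eq_center_iff (hℓ : 0 < ℓ) (hq : q ∈ sphere c ℓ) (hm : ψ q < m) (hh : h ≤ m) :
    levelPt c m ψ q h = c ↔ h = m := by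
  constructor
  · intro h'
    have := radial_levelPt hℓ hq hm hh
    rw [h', radial_center] at this
    have h0 : m - h = 0 := by
      have hne : m - ψ q ≠ 0 := by linarith
      field_simp at this
      linarith
    linarith
  · rintro rfl
    simp [levelPt]

/-- **Uniqueness on each ray**: a point of the square at height `h` is the level point of its
projection. [folklore] -/
theorem eq_levelPt_of_coneHt_eq (hℓ : 0 < ℓ) (hm : ∀ q ∈ sphere c ℓ, ψ q < m) (hx : coneHt c ℓ m ψ x = h) :
    x = levelPt c m ψ (proj c ℓ x) h := by
  have hq := proj_mem_sphere hℓ x (c := c)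
  have hψ := hm _ hq
  have hr : radial c ℓ x = (m - h) / (m - ψ (proj c ℓ x)) := by
    rw [coneHt_eq] at hx
    rw [eq_div_iff (by linarith : m - ψ (proj c ℓ x) ≠ 0)]
    linarith
  conv_lhs => rw [eq_center_add_radial_smul hℓ x (c := c), hr]
  rfl

/-- **The level set of height `h`** in the square is the set of level points over the boundary
arc `{q | ψ q ≤ h}` (for `h < m`; the level `m` is the centre). [folklore] -/
theorem coneHt_eq_iff (hℓ : 0 < ℓ) (hm : ∀ q ∈ sphere c ℓ, ψ q < m) (hh : h < m) (hx : x ∈ closedBall c ℓ) :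
    coneHt c ℓ m ψ x = h ↔ ∃ q ∈ sphere c ℓ, ψ q ≤ h ∧ x = levelPt c m ψ q h := by
  constructor
  · intro hxh
    refine ⟨proj c ℓ x, proj_mem_sphere hℓ x, ?_, eq_levelPt_of_coneHt_eq hℓ hm hxh⟩
    have := le_coneHt hℓ hm hx
    rwa [hxh] at this
  · rintro ⟨q, hq, -, rfl⟩
    exact coneHt_levelPt hℓ hq (hm q hq) hh.le

/-! ## Continuity of the level points -/

/-- **The level points depend continuously on `(q, h)`** (boundary heights continuous on the
boundary, `h ≤ m`... in fact for all `h`). [folklore] -/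
theorem continuousOn_levelPt (hm : ∀ q ∈ sphere c ℓ, ψ q < m) (hψ : ContinuousOn ψ (sphere c ℓ)) :
    ContinuousOn (fun p : (ℝ × ℝ) × ℝ ↦ levelPt c m ψ p.1 p.2) (sphere c ℓ ×ˢ univ) := by
  have h1 : ContinuousOn (fun p : (ℝ × ℝ) × ℝ ↦ (m - p.2) / (m - ψ p.1)) (sphere c ℓ ×ˢ univ) := by
    refine ContinuousOn.div (by fun_prop) ?_ ?_
    · exact continuousOn_const.sub (hψ.comp continuousOn_fst fun p hp ↦ hp.1)
    · rintro ⟨q, h⟩ ⟨hq, -⟩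
      exact ne_of_gt (sub_pos.2 (hm q hq))
  exact continuousOn_const.add (h1.smul (continuousOn_fst.sub continuousOn_const))

/-- The height is continuous on the square away from the centre (boundary heights continuous).
[folklore] -/
theorem continuousOn_coneHt (hℓ : 0 < ℓ) (hψ : ContinuousOn ψ (sphere c ℓ)) : ContinuousOn (coneHt c ℓ m ψ) {c}ᶜ := by
  refine ((continuousOn_const.sub (continuous_radial c ℓ).continuousOn).mul continuousOn_const).add
    ((continuous_radial c ℓ).continuousOn.mul (hψ.comp (continuousOn_proj c ℓ) fun x _ ↦ proj_mem_sphere hℓ x))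

/-- **Cone coordinates of the punctured square**: `x ↦ (proj x, coneHt x)` and
`(q, h) ↦ levelPt q h` are inverse to each other between the punctured square and the region
`{(q, h) | q ∈ ∂Q, ψ q ≤ h < m}`. [folklore] -/
theorem levelPt_proj_coneHt (hℓ : 0 < ℓ) (hm : ∀ q ∈ sphere c ℓ, ψ q < m) (x : ℝ × ℝ) :
    levelPt c m ψ (proj c ℓ x) (coneHt c ℓ m ψ x) = x :=
  (eq_levelPt_of_coneHt_eq hℓ hm rfl).symm

/-- The other composite: `(proj, coneHt) ∘ levelPt = id` on the region (below the apex).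
[folklore] -/
theorem proj_coneHt_levelPt (hℓ : 0 < ℓ) (hq : q ∈ sphere c ℓ) (hm : ψ q < m) (hh : h < m) :
    (proj c ℓ (levelPt c m ψ q h), coneHt c ℓ m ψ (levelPt c m ψ q h)) = (q, h) := by
  rw [proj_levelPt hℓ hq hm hh, coneHt_levelPt hℓ hq hm hh.le]

/-- The region over the boundary maps onto the punctured square. [folklore] -/
theorem levelPt_mem_of_mem_region (hℓ : 0 < ℓ) (hq : q ∈ sphere c ℓ) (hm : ψ q < m) (hψh : ψ q ≤ h) (hh : h < m) :
    levelPt c m ψ q h ∈ closedBall c ℓ \ {c} := by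
  refine ⟨(levelPt_mem_closedBall_iff hℓ hq hm hh.le).2 hψh, fun h' ↦ ?_⟩
  have := (levelPt_eq_center_iff hℓ hq hm hh.le).1 h'
  linarith

/-- The punctured square maps into the region. [folklore] -/
theorem proj_coneHt_mem_region (hℓ : 0 < ℓ) (hm : ∀ q ∈ sphere c ℓ, ψ q < m) (hx : x ∈ closedBall c ℓ \ {c}) :
    proj c ℓ x ∈ sphere c ℓ ∧ ψ (proj c ℓ x) ≤ coneHt c ℓ m ψ x ∧ coneHt c ℓ m ψ x < m :=
  ⟨proj_mem_sphere hℓ x, le_coneHt hℓ hm hx.1, coneHt_lt_apex hℓ hm hx.2⟩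

end ConeSquare

end Literature.Topology.FourManifolds
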